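import Literature.MathematicalPhysics.QuantumFieldTheory.Balaban1983to89.B9Thm313Whole

/-!
# `Balaban1983to89.B9Thm313WholeZ` — [B9] Theorem 3.13 (p. 426), the coarse letters RE-CLASSED: `Letters313` with (QG₁Q\*)⁻¹ and G₀Q\* read through
# a WEIGHTED coarse class with ONE free weight `wZ` (repair road R1-cls of the located vacuity «C-LETTER-FLAT-AT-ONE»), and the two sup entries of 𝔊
# re-proved over them

T. Bałaban, *Propagators for lattice gauge theories in a background field*, Commun. Math. Phys. **99** (1985) 389–434 [`Balaban1985BackgroundPropagators`,
"B9"]; [4] = T. Bałaban, *Propagators and renormalization transformations for lattice gauge theories. II*, Commun. Math. Phys. **96** (1984) 223–250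
[`Balaban1984PropagatorsII`].  statement-level skeleton of published theorems with citation tags; proofs where landed; nothing here is a claim about
the Yang–Mills mass gap.

THE PRINT.  p. 426: *"The formulas (3.147), (3.153) permit us to reduce properties of the operators 𝔓, 𝔊 to the corresponding properties of the operators G′,
(Q′G′²Q′\*)⁻¹, G₁, (QG₁Q\*)⁻¹"*; (3.153) 𝔊 = G₁ − G₁Q\*(QG₁Q\*)⁻¹QG₁ − G₁DRD\*G₁; (3.132) p. 422.

WHY THIS FILE (pub-ymgap bus 2026-08-27: dag-n06-h `B9LettersHCOneObstruction` — the flat coarse class of the (3.132) letters is unsatisfiable at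
node00-def-Y's flat `C1coK`; def-Y WORD (W2); director-ym LINE №198; dag-n06-l R-WORD «R1-cls»; twin of `B9Thm312WholeHZ` for row 21).  In
`B9Thm313Whole.Letters313` the factorisations G₁Q\*·(QG₁Q\*)⁻¹ are read through the flat coarse class 𝔠_Z⁽⁰⁾ (`gQs2 : Z⁰ → 𝔠²`, `c1_2 : Z² → Z⁰`) and the
len-weighted one (`gQs1 : Z^{len} → 𝔠¹`, `c1_1 : Z¹ → Z^{len}`).  HERE both middle classes are WEIGHTED sharp-block classes with ONE free positive weight
`wZ : 𝔅 → ℝ`: `Z_{wZ} := B9SectDSup.weightNorm (BlockNorm.ofBlocks … blkZ) wZ` for the undifferentiated factorisation and `Z_{len·wZ}` for the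
differentiated one (the knit pins `wZ := n⁻¹` with def-Y's block count n = (Lʲη∕η)^{d+1}, in which both sides are member-uniform; the ratio `len` between the
two classes is print's scale transfer (2.60), kept from the old schema); `wZ ≡ 1` IS the old schema definitionally (`cNorm … blkZ … 0 = weightNorm … (wt g 0)`).
The 𝔊-cores re-prove VERBATIM (`hasMaj_right_of_step_weight` for the G₀Q\* step, `hasMaj_frakG_classes` is class-agnostic):
* §1 `Letters313Z 𝔬 R₀ H₀ hG wZ hwZ B₃ δ₃ U` — HYPOTHESIS SCHEMA, nothing asserted (fields of `Letters313` with the two middle classes re-typed);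
* §2 ★ `GG_entry0_of_lettersZ`, ★ `GG_entry2_of_lettersZ` — statements of `GG_entry0_of_letters ∕ GG_entry2_of_letters` over `Letters313Z`, same constants
  `const313 …`, same rates.
The remaining row-21 cores that read the coarse letters (`B9Thm313WholeLeft ∕ Dir ∕ DirInput ∕ DirInputB ∕ Input ∕ Holder`) and the consumed leaf
`…LeafCompletePairMB` are re-issued over `Letters313Z` in sequels (same seat ∕ successor).
HONEST SCOPE.  Count-neutral schema re-classing + kernel-checked bookkeeping; Theorem 3.1, (3.49), (3.132), (3.152)–(3.153)'s estimates are NOT proved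
(hypotheses of printed shape, now in satisfiable classes); N06 NOT discharged; one finite lattice at a time — nothing continuum ∕ ℝ⁴ ∕ OS ∕ mass gap ∕
Clay.  Cell `pub-ymgap` (HUMAN RULING D-0062), Track A node N06 [B9], bundle F7 rows 20–21, seat `pub-ymgap-dag-n06-l` (g14), 2026-08-27.  NEW file;
`Letters313` stays as a record; nothing landed is modified.
-/

namespace Literature.MathematicalPhysics.QuantumFieldTheory.Balaban1983to89.B9Thm313WholeZ

open Literature.MathematicalPhysics.QuantumFieldTheory.Balaban1983to89
open Finset Filter B6RandomWalk B6RandomWalkHom B9Thm34Ext B9Thm37GlueCor36 B11SectG B9SectDSup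
open B9Thm37AllNorms B9Thm37AllNormsInstances B9FromB6 B9FromB6ModelSignsOn B9SectBStepWhole B9Thm312Whole B9Thm312WholeLeaf B9Thm313Whole

noncomputable section

section OneMember

variable {g : B9.Geometry} {B : B9.Backgrounds} {X Y Z W : Type}
variable [Fintype X] [Fintype Y] [Fintype Z] [Fintype W] [Fintype g.Site]

/-! ## §1 The re-classed letters (printed shape; nothing asserted) -/

omit [Fintype X] [Fintype Y] [Fintype Z] [Fintype W] [Fintype g.Site] in
/-- the weight Lʲη·w of the differentiated coarse class is positive when w is ((3.41): Lʲη > 0). [cite: Balaban1985BackgroundPropagators, (3.41) p.397 (bookkeeping)] -/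
theorem wZlen_pos (hG : GeoOK g) {wZ : g.Site → ℝ} (hwZ : ∀ y, 0 < wZ y) (y : g.Site) : 0 < g.len y * wZ y :=
  mul_pos (hG.lenpos y) (hwZ y)


/-- **THE LETTERS OF THEOREM 3.13's REDUCTION AT U, COARSE FACTORS THROUGH WEIGHTED CLASSES** (R1-cls form of `B9Thm313Whole.Letters313`): all fields
of `Letters313` verbatim except the four that meet the coarse lattice twice — `gQs2 : Z_{wZ} → 𝔠²`, `c1_2 : Z² → Z_{wZ}`, `gQs1 : Z_{len·wZ} → 𝔠¹`,
`c1_1 : Z¹ → Z_{len·wZ}`, `Z_{w} := weightNorm (BlockNorm.ofBlocks … blkZ) w` (size near y = w(y)·sup over the block).  NOTHING ASSERTED.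
[cite: Balaban1985BackgroundPropagators, Thm 3.13 p.426 + (3.152)–(3.153) p.426 + (3.132) p.422 + (3.126) p.420 + p.398 (remark after (3.47))] -/
structure Letters313Z (𝔬 : Ops g B X Y Z W) (R₀ : ℝ) (H₀ : Prop) (hG : GeoOK g) (wZ : g.Site → ℝ) (hwZ : ∀ y, 0 < wZ y) (B₃ δ₃ : ℝ)
    (U : B.Cfg) : Prop where
  gD1 : HasMaj (cNorm R₀ H₀ 𝔬.blkW hG.lenle 0) (cNorm R₀ H₀ 𝔬.blk hG.lenle 1) (𝔬.G0 U ∘ₗ 𝔬.Dv U)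
    (fun a b => B₃ * Real.exp (-(δ₃ * g.dist a b)))
  gD2 : HasMaj (cNorm R₀ H₀ 𝔬.blkW hG.lenle 1) (cNorm R₀ H₀ 𝔬.blk hG.lenle 2) (𝔬.G0 U ∘ₗ 𝔬.Dv U)
    (fun a b => B₃ * Real.exp (-(δ₃ * g.dist a b)))
  gQs2 : HasMaj (weightNorm (BlockNorm.ofBlocks (toB6 g R₀ H₀) 𝔬.blkZ) wZ fun y => (hwZ y).le) (cNorm R₀ H₀ 𝔬.blk hG.lenle 2)
    (𝔬.G0 U ∘ₗ 𝔬.Qstar U)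
    (fun a b => B₃ * Real.exp (-(δ₃ * g.dist a b)))
  gQs1 : HasMaj (weightNorm (BlockNorm.ofBlocks (toB6 g R₀ H₀) 𝔬.blkZ) (fun y => g.len y * wZ y) fun y => (wZlen_pos hG hwZ y).le)
    (cNorm R₀ H₀ 𝔬.blk hG.lenle 1) (𝔬.G0 U ∘ₗ 𝔬.Qstar U) (fun a b => B₃ * Real.exp (-(δ₃ * g.dist a b)))
  rgd2 : HasMaj (cNorm R₀ H₀ 𝔬.blk hG.lenle 0) (cNorm R₀ H₀ 𝔬.blkW hG.lenle 1) (𝔬.R U ∘ₗ 𝔬.Dvstar U ∘ₗ 𝔬.G1 U ∘ₗ LinearMap.id)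
    (fun a b => B₃ * Real.exp (-(δ₃ * g.dist a b)))
  rgd1 : HasMaj (cNorm R₀ H₀ 𝔬.blkY hG.lenle 0) (cNorm R₀ H₀ 𝔬.blkW hG.lenle 0) (𝔬.R U ∘ₗ 𝔬.Dvstar U ∘ₗ 𝔬.G1 U ∘ₗ 𝔬.Dstar U)
    (fun a b => B₃ * Real.exp (-(δ₃ * g.dist a b)))
  c1_2 : HasMaj (cNorm R₀ H₀ 𝔬.blkZ hG.lenle 2) (weightNorm (BlockNorm.ofBlocks (toB6 g R₀ H₀) 𝔬.blkZ) wZ fun y => (hwZ y).le) (𝔬.C1 U)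
    (fun a b => B₃ * Real.exp (-(δ₃ * g.dist a b)))
  c1_1 : HasMaj (cNorm R₀ H₀ 𝔬.blkZ hG.lenle 1)
    (weightNorm (BlockNorm.ofBlocks (toB6 g R₀ H₀) 𝔬.blkZ) (fun y => g.len y * wZ y) fun y => (wZlen_pos hG hwZ y).le) (𝔬.C1 U)
    (fun a b => B₃ * Real.exp (-(δ₃ * g.dist a b)))
  q2 : HasMaj (cNorm R₀ H₀ 𝔬.blk hG.lenle 2) (cNorm R₀ H₀ 𝔬.blkZ hG.lenle 2) (𝔬.Q U) (fun a b => B₃ * Real.exp (-(δ₃ * g.dist a b)))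
  q1 : HasMaj (cNorm R₀ H₀ 𝔬.blk hG.lenle 1) (cNorm R₀ H₀ 𝔬.blkZ hG.lenle 1) (𝔬.Q U) (fun a b => B₃ * Real.exp (-(δ₃ * g.dist a b)))

/-! ## §2 One member, one U: the sup entries (3.42)₁, (3.42)₃ of 𝔊 over the re-classed letters -/

/-- **THEOREM 3.13, ENTRY (3.42)₁ FOR 𝔊, PRINTED SHAPE, COARSE LETTERS THROUGH THE WEIGHTED CLASS Z_{wZ}** (statement of
`B9Thm313Whole.GG_entry0_of_letters` over `Letters313Z`) — the reduction at U: from Theorem 3.3 (3.42)₁ for G₀ (B₀(L^jη)²e^{−δ₀d}), the step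
K′₁ = G₀(Δ′_π + Δ⁽²⁾_π) on 𝔠⁽²⁾ (θe^{−δ_K d}, θc < 1), the resolvent identity of (3.138), the letters `gD2`, `gQs2`, `rgd2`, `c1_2`, `q2`
(constant B₃, rate δ₃ ≧ ρ) and (3.153): |(𝔊λ)(x)| ≦ C(L^jη)²e^{−ρ′d(y,y′)}|λ| for x ∈ Δ(y), supp λ ⊂ Δ(y′), with
C = `const313 (B₀(1−θc)⁻¹) (B₃(1−θc)⁻¹) B₃ c` and every ρ′ ≧ 0 with ρ′ + 3σ ≦ ρ (ρ ≦ δ₀, ρ ≦ δ₃, ρ + σ ≦ δ_K).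
[cite: Balaban1985BackgroundPropagators, Thm 3.13 p.426 + (3.153) p.426 + (3.138) p.423 + (3.42) p.397] -/
theorem GG_entry0_of_lettersZ {R₀ : ℝ} {H₀ : Prop} (hG : GeoOK g) {𝔬 : Ops g B X Y Z W} {U : B.Cfg}
    {θ B₀ B₃ δ₀ δ₃ δK ρ ρ' σ c : ℝ} (hrow : RowSum (toB6 g R₀ H₀) σ c) (hc : 0 ≤ c)
    (hθ : 0 ≤ θ) (hB₀ : 0 ≤ B₀) (hB₃ : 0 ≤ B₃) (hσ : 0 ≤ σ) (hρ' : 0 ≤ ρ') (hρ'ρ : ρ' + 3 * σ ≤ ρ) (hρS : ρ ≤ δ₀)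
    (hρ₃ : ρ ≤ δ₃) (hρδ : ρ + σ ≤ δK) (hq : θ * c < 1)
    (hK : HasMaj (cNorm R₀ H₀ 𝔬.blk hG.lenle 2) (cNorm R₀ H₀ 𝔬.blk hG.lenle 2) (𝔬.G0 U ∘ₗ (𝔬.Tpi U + 𝔬.T2 U))
      (fun a b => θ * Real.exp (-(δK * g.dist a b))))
    (he0 : HasMajorant (g := toB6 g R₀ H₀) 𝔬.blk (𝔬.G0 U) (fun a b => B₀ * g.len a ^ 2 * Real.exp (-(δ₀ * g.dist a b))))
    {wZ : g.Site → ℝ} {hwZ : ∀ y, 0 < wZ y}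
    (hL : Letters313Z 𝔬 R₀ H₀ hG wZ hwZ B₃ δ₃ U) (hI : Identities 𝔬 U) :
    HasMajorant (g := toB6 g R₀ H₀) 𝔬.blk (𝔬.GG U)
      (fun a b => const313 (B₀ * (1 - θ * c)⁻¹) (B₃ * (1 - θ * c)⁻¹) B₃ c * g.len a ^ 2 *
        Real.exp (-(ρ' * g.dist a b))) := by
  have hq1 : 0 ≤ (1 - θ * c)⁻¹ := inv_nonneg.mpr (by linarith)
  have hA₁ : 0 ≤ B₀ * (1 - θ * c)⁻¹ := mul_nonneg hB₀ hq1
  have hA₃ : 0 ≤ B₃ * (1 - θ * c)⁻¹ := mul_nonneg hB₃ hq1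
  have hfix1 := fix_of_inverses hI.invG0' hI.invG1
  have hρ0 : 0 ≤ ρ := by linarith
  have htri : Triangle254 (toB6 g R₀ H₀) := fun a b c => hG.tri a b c
  -- (a) G₁ : 𝔠⁽⁰⁾ → 𝔠⁽²⁾
  have h0 : HasMaj (BlockNorm.ofBlocks (toB6 g R₀ H₀) 𝔬.blk) (BlockNorm.ofBlocks (toB6 g R₀ H₀) 𝔬.blk) (𝔬.G0 U)
      (fun a b => B₀ * g.len a ^ 2 * Real.exp (-(δ₀ * g.dist a b))) :=
    hasMaj_of_hasMajorant (g := toB6 g R₀ H₀) 𝔬.blk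
      (fun a b => mul_nonneg (mul_nonneg hB₀ (sq_nonneg _)) (Real.exp_nonneg _)) he0
  have hS : HasMaj (cNorm R₀ H₀ 𝔬.blk hG.lenle 0) (cNorm R₀ H₀ 𝔬.blk hG.lenle 2) (𝔬.G0 U ∘ₗ LinearMap.id)
      (fun a b => B₀ * Real.exp (-(δ₀ * g.dist a b))) := by
    rw [LinearMap.comp_id]
    refine (hasMaj_cNorm_of_hasMaj hG 2 0 h0).mono fun y y' => le_of_eq ?_
    have hy : g.len y ^ 2 ≠ 0 := pow_ne_zero 2 (hG.lenpos y).ne'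
    simp only [wt, pow_zero, mul_one]
    rw [mul_assoc B₀, mul_comm (g.len y ^ 2), ← mul_assoc B₀, mul_assoc, mul_assoc, mul_inv_cancel₀ hy, mul_one]
  have hG1 := hasMaj_right_of_step hG hrow hθ hB₀ hρ0 hρS hρδ hK hS hfix1 hq
  -- (b) G₁D : W¹ → 𝔠⁽²⁾, (c) G₁Q* : Z⁰ → 𝔠⁽²⁾
  have hGD := hasMaj_right_of_step hG hrow hθ hB₃ hρ0 hρ₃ hρδ hK hL.gD2 hfix1 hq
  have hGQ := hasMaj_right_of_step_weight hG hwZ hrow hθ hB₃ hρ0 hρ₃ hρδ hK hL.gQs2 hfix1 hq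
  -- (d) QG₁ : 𝔠⁽⁰⁾ → Z², rate ρ′ + 2σ
  have hQG : HasMaj (cNorm R₀ H₀ 𝔬.blk hG.lenle 0) (cNorm R₀ H₀ 𝔬.blkZ hG.lenle 2) (𝔬.Q U ∘ₗ (𝔬.G1 U ∘ₗ LinearMap.id))
      (fun a b => (cNorm R₀ H₀ 𝔬.blk hG.lenle 2 (X := X)).κ * B₃ * (B₀ * (1 - θ * c)⁻¹) * c *
        Real.exp (-((ρ' + 2 * σ) * g.dist a b))) :=
    hasMaj_comp_exp htri hG.dnn hrow hB₃ hA₁ (by linarith) (by linarith) (by linarith) hL.q2 hG1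
  simp only [cNorm_κ, one_mul] at hQG
  -- all six letters at the rate δ := ρ′ + 2σ
  have hδ₁ : ρ' + 2 * σ ≤ ρ := by linarith
  have hδ₃ : ρ' + 2 * σ ≤ δ₃ := by linarith
  have h := hasMaj_frakG_classes (bA := cNorm R₀ H₀ 𝔬.blk hG.lenle 0) (bC := cNorm R₀ H₀ 𝔬.blk hG.lenle 2)
    (bP := cNorm R₀ H₀ 𝔬.blkW hG.lenle 1) (bQ₁ := cNorm R₀ H₀ 𝔬.blkZ hG.lenle 2)
    (bQ₂ := weightNorm (BlockNorm.ofBlocks (toB6 g R₀ H₀) 𝔬.blkZ) wZ fun y => (hwZ y).le)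
    htri hG.dnn hrow hA₁ hA₃ hB₃ hA₃ hB₃ (mul_nonneg (mul_nonneg hB₃ hA₁) hc) hρ' hσ le_rfl
    (hG1.of_rate_le hG.dnn hA₁ hδ₁) (hGD.of_rate_le hG.dnn hA₃ hδ₁) (hL.rgd2.of_rate_le hG.dnn hB₃ hδ₃)
    (hGQ.of_rate_le hG.dnn hA₃ hδ₁) (hL.c1_2.of_rate_le hG.dnn hB₃ hδ₃) (hQG.of_rate_le hG.dnn
      (mul_nonneg (mul_nonneg hB₃ hA₁) hc) le_rfl)
  rw [← GG_comp_eq hI LinearMap.id, LinearMap.comp_id] at h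
  simp only [cNorm_κ, weightNorm_ofBlocks_κ, one_mul] at h
  have hC0 : 0 ≤ const313 (B₀ * (1 - θ * c)⁻¹) (B₃ * (1 - θ * c)⁻¹) B₃ c := const313_nonneg hA₁ hA₃ hB₃ hc
  have h2 : HasMaj (cNorm R₀ H₀ 𝔬.blk hG.lenle 0) (cNorm R₀ H₀ 𝔬.blk hG.lenle 2) (𝔬.GG U)
      (fun a b => const313 (B₀ * (1 - θ * c)⁻¹) (B₃ * (1 - θ * c)⁻¹) B₃ c * Real.exp (-(ρ' * g.dist a b))) :=
    h.mono fun a b => le_of_eq rfl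
  have h' := hasMajorantHom_of_hasMaj_cNorm hG (fun a b => mul_nonneg hC0 (Real.exp_nonneg _)) h2
  rw [hasMajorantHom_iff] at h'
  refine hasMajorant_mono (g := toB6 g R₀ H₀) 𝔬.blk h' fun a b => le_of_eq ?_
  simp only [wt, pow_zero, inv_one, mul_one]
  ring

/-- **THEOREM 3.13, ENTRY (3.42)₃ FOR 𝔊, PRINTED SHAPE, COARSE LETTERS THROUGH THE WEIGHTED CLASS Z_{len·wZ}** (statement of
`B9Thm313Whole.GG_entry2_of_letters` over `Letters313Z`) — the reduction at U for 𝔊∇*_U: from Theorem 3.3 (3.42)₃ for G₀ (B₀L^jη·e^{−δ₀d}), the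
step K′₁ on 𝔠⁽¹⁾, the resolvent identity of (3.138), the letters `gD1`, `gQs1`, `rgd1`, `c1_1`, `q1` and (3.153): |(𝔊∇*_Uμ)(x)| ≦
C·L^jη·e^{−ρ′d(y,y′)}|μ| for x ∈ Δ(y), supp μ ⊂ Δ(y′), C = `const313 (B₀(1−θc)⁻¹) (B₃(1−θc)⁻¹) B₃ c`, ρ′ + 3σ ≦ ρ.
[cite: Balaban1985BackgroundPropagators, Thm 3.13 p.426 + (3.153) p.426 + (3.138) p.423 + (3.42) p.397] -/
theorem GG_entry2_of_lettersZ {R₀ : ℝ} {H₀ : Prop} (hG : GeoOK g) {𝔬 : Ops g B X Y Z W} {U : B.Cfg}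
    {θ B₀ B₃ δ₀ δ₃ δK ρ ρ' σ c : ℝ} (hrow : RowSum (toB6 g R₀ H₀) σ c) (hc : 0 ≤ c)
    (hθ : 0 ≤ θ) (hB₀ : 0 ≤ B₀) (hB₃ : 0 ≤ B₃) (hσ : 0 ≤ σ) (hρ' : 0 ≤ ρ') (hρ'ρ : ρ' + 3 * σ ≤ ρ) (hρS : ρ ≤ δ₀)
    (hρ₃ : ρ ≤ δ₃) (hρδ : ρ + σ ≤ δK) (hq : θ * c < 1)
    (hK : HasMaj (cNorm R₀ H₀ 𝔬.blk hG.lenle 1) (cNorm R₀ H₀ 𝔬.blk hG.lenle 1) (𝔬.G0 U ∘ₗ (𝔬.Tpi U + 𝔬.T2 U))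
      (fun a b => θ * Real.exp (-(δK * g.dist a b))))
    (he2 : HasMajorantHom (g := toB6 g R₀ H₀) 𝔬.blkY 𝔬.blk (𝔬.G0 U ∘ₗ 𝔬.Dstar U)
      (fun a b => B₀ * g.len a * Real.exp (-(δ₀ * g.dist a b))))
    {wZ : g.Site → ℝ} {hwZ : ∀ y, 0 < wZ y}
    (hL : Letters313Z 𝔬 R₀ H₀ hG wZ hwZ B₃ δ₃ U) (hI : Identities 𝔬 U) :
    HasMajorantHom (g := toB6 g R₀ H₀) 𝔬.blkY 𝔬.blk (𝔬.GG U ∘ₗ 𝔬.Dstar U)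
      (fun a b => const313 (B₀ * (1 - θ * c)⁻¹) (B₃ * (1 - θ * c)⁻¹) B₃ c * g.len a *
        Real.exp (-(ρ' * g.dist a b))) := by
  have hq1 : 0 ≤ (1 - θ * c)⁻¹ := inv_nonneg.mpr (by linarith)
  have hA₁ : 0 ≤ B₀ * (1 - θ * c)⁻¹ := mul_nonneg hB₀ hq1
  have hA₃ : 0 ≤ B₃ * (1 - θ * c)⁻¹ := mul_nonneg hB₃ hq1
  have hfix1 := fix_of_inverses hI.invG0' hI.invG1
  have hρ0 : 0 ≤ ρ := by linarith
  have htri : Triangle254 (toB6 g R₀ H₀) := fun a b c => hG.tri a b c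
  -- (a′) G₁∇* : Y⁰ → 𝔠⁽¹⁾
  have h0 : HasMaj (BlockNorm.ofBlocks (toB6 g R₀ H₀) 𝔬.blkY) (BlockNorm.ofBlocks (toB6 g R₀ H₀) 𝔬.blk)
      (𝔬.G0 U ∘ₗ 𝔬.Dstar U) (fun a b => B₀ * g.len a * Real.exp (-(δ₀ * g.dist a b))) :=
    hasMaj_of_hasMajorantHom (G := toB6 g R₀ H₀) 𝔬.blkY 𝔬.blk
      (fun a b => mul_nonneg (mul_nonneg hB₀ (hG.lenle a)) (Real.exp_nonneg _)) he2
  have hS : HasMaj (cNorm R₀ H₀ 𝔬.blkY hG.lenle 0) (cNorm R₀ H₀ 𝔬.blk hG.lenle 1) (𝔬.G0 U ∘ₗ 𝔬.Dstar U)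
      (fun a b => B₀ * Real.exp (-(δ₀ * g.dist a b))) := by
    refine (hasMaj_cNorm_of_hasMaj hG 1 0 h0).mono fun y y' => le_of_eq ?_
    have hy : g.len y ≠ 0 := (hG.lenpos y).ne'
    simp only [wt, pow_zero, pow_one, mul_one]
    rw [mul_assoc B₀, mul_comm (g.len y), ← mul_assoc B₀, mul_assoc, mul_inv_cancel₀ hy, mul_one]
  have hG1 := hasMaj_right_of_step hG hrow hθ hB₀ hρ0 hρS hρδ hK hS hfix1 hq
  -- (b′) G₁D : W⁰ → 𝔠⁽¹⁾, (c′) G₁Q* : Z^{len} → 𝔠⁽¹⁾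
  have hGD := hasMaj_right_of_step hG hrow hθ hB₃ hρ0 hρ₃ hρδ hK hL.gD1 hfix1 hq
  have hGQ := hasMaj_right_of_step_weight hG (wZlen_pos hG hwZ) hrow hθ hB₃ hρ0 hρ₃ hρδ hK hL.gQs1 hfix1 hq
  -- (d′) QG₁∇* : Y⁰ → Z¹
  have hQG : HasMaj (cNorm R₀ H₀ 𝔬.blkY hG.lenle 0) (cNorm R₀ H₀ 𝔬.blkZ hG.lenle 1) (𝔬.Q U ∘ₗ (𝔬.G1 U ∘ₗ 𝔬.Dstar U))
      (fun a b => (cNorm R₀ H₀ 𝔬.blk hG.lenle 1 (X := X)).κ * B₃ * (B₀ * (1 - θ * c)⁻¹) * c *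
        Real.exp (-((ρ' + 2 * σ) * g.dist a b))) :=
    hasMaj_comp_exp htri hG.dnn hrow hB₃ hA₁ (by linarith) (by linarith) (by linarith) hL.q1 hG1
  simp only [cNorm_κ, one_mul] at hQG
  have hδ₁ : ρ' + 2 * σ ≤ ρ := by linarith
  have hδ₃ : ρ' + 2 * σ ≤ δ₃ := by linarith
  have h := hasMaj_frakG_classes (bA := cNorm R₀ H₀ 𝔬.blkY hG.lenle 0) (bC := cNorm R₀ H₀ 𝔬.blk hG.lenle 1)
    (bP := cNorm R₀ H₀ 𝔬.blkW hG.lenle 0) (bQ₁ := cNorm R₀ H₀ 𝔬.blkZ hG.lenle 1)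
    (bQ₂ := weightNorm (BlockNorm.ofBlocks (toB6 g R₀ H₀) 𝔬.blkZ) (fun y => g.len y * wZ y) fun y => (wZlen_pos hG hwZ y).le)
    htri hG.dnn hrow hA₁ hA₃ hB₃ hA₃ hB₃ (mul_nonneg (mul_nonneg hB₃ hA₁) hc) hρ' hσ le_rfl
    (hG1.of_rate_le hG.dnn hA₁ hδ₁) (hGD.of_rate_le hG.dnn hA₃ hδ₁) (hL.rgd1.of_rate_le hG.dnn hB₃ hδ₃)
    (hGQ.of_rate_le hG.dnn hA₃ hδ₁) (hL.c1_1.of_rate_le hG.dnn hB₃ hδ₃) (hQG.of_rate_le hG.dnn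
      (mul_nonneg (mul_nonneg hB₃ hA₁) hc) le_rfl)
  rw [← GG_comp_eq hI (𝔬.Dstar U)] at h
  simp only [cNorm_κ, weightNorm_ofBlocks_κ, one_mul] at h
  have hC0 : 0 ≤ const313 (B₀ * (1 - θ * c)⁻¹) (B₃ * (1 - θ * c)⁻¹) B₃ c := const313_nonneg hA₁ hA₃ hB₃ hc
  have h2 : HasMaj (cNorm R₀ H₀ 𝔬.blkY hG.lenle 0) (cNorm R₀ H₀ 𝔬.blk hG.lenle 1) (𝔬.GG U ∘ₗ 𝔬.Dstar U)
      (fun a b => const313 (B₀ * (1 - θ * c)⁻¹) (B₃ * (1 - θ * c)⁻¹) B₃ c * Real.exp (-(ρ' * g.dist a b))) :=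
    h.mono fun a b => le_of_eq rfl
  have h' := hasMajorantHom_of_hasMaj_cNorm hG (fun a b => mul_nonneg hC0 (Real.exp_nonneg _)) h2
  refine hasMajorantHom_mono (g := toB6 g R₀ H₀) 𝔬.blkY 𝔬.blk h' fun a b => le_of_eq ?_
  simp only [wt, pow_zero, pow_one, inv_one, mul_one]
  ring

end OneMember

end

end Literature.MathematicalPhysics.QuantumFieldTheory.Balaban1983to89.B9Thm313WholeZ
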